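import Summits.BirchSwinnertonDyer.Rank1Residual.GaloisImage.CanonicalKolyvaginDatumAdmissibleDeep
import HarnessLib

/-!
# `H¹_ur(K_𝔮, T) ≅ T/(Fr_𝔮 − 1)T ≅ ℤ/N` and `H¹(K_𝔮, T)/H¹_ur ≅ ℤ/N` at Sakamoto's primes — the last
# sentence of [MR04] Lemma 1.2.3 ("In particular both `H¹_f(K,T)` and `H¹_s(K,T)` are free of rank
# one over `R`") as ISOMORPHISMS, not only counts
# (cell `b2b-bsdres`, team n1011; row T-HCC-adm, appendix; seat p11 gen 4, ON-CALL item)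

HONEST FRAMING (cell `b2b-bsdres`, run/shared/lean/b2b/bsd-rank1-residual/, verbatim in every
file): the goal of the cell is to DELETE the COMBINATION-SHAPED residual classes of the
Birch–Swinnerton-Dyer formula for ALL analytic-rank `≤ 1` elliptic curves over `ℚ` — "full BSD
formula for every rank `≤ 1` curve in class `C`" assembled STRICTLY from published theorems — so
that the rank-`≤ 1` remainder becomes exactly the CONSTRUCTION-SHAPED classes, which are TYPED
(missing-input `Prop`s), NOT attempted. This is not "finishing BSD". Team n1011 (N10 / N11, the
additive block X4 ∧ `p = 3`): research route; TOOL theorems of local Galois cohomology (no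
definition, no named fact, no `sorry`); nothing is booked; no mark / label moved.

## What

* `FSComp.nonempty_unramifiedSubgroup_addEquiv_cokerSubOne` — **Rubin PCMI Prop. 1.4.13 (1) /
  [MR04] Lemma 1.2.1 (i) as an ISOMORPHISM**: for a non-archimedean local field `F`, a FINITE
  unramified discrete `Γ_F`-module `M` and an arithmetic Frobenius `φ`, evaluation of cocycles at
  `φ` induces `H¹_ur(F, M) ≃+ M/(φ − 1)M` (descends to classes since coboundaries evaluate into
  `(φ − 1)M`; injective by file 3's `oneCocycleClass_eq_zero_of_apply_frob_eq`; onto by the count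
  `#H¹_ur = #M^{Γ_F} = #M^{φ=1} = #M/(φ − 1)M`, n1011-p18 / n1011-p04).
* `FSComp.isFreeRankOneZMod_unramifiedSubgroup_of_mem_frobeniusClassPrimes` — at a prime of
  Sakamoto's `τ`-class over ANY number field with (H.2) `T/(τ − 1)T ≅ ℤ/N`:
  `H¹_ur(K_𝔮, T)` is free of rank one over `ℤ/N` (`KolyvaginSystem.IsFreeRankOneZMod`; a local
  Frobenius acts as a conjugate of `τ`, n1011-p04 `exists_toLocal_eq_conj`).
* `FSComp.isFreeRankOneZMod_singularQuotient_of_hasCanonicalComparison_primePow` — over `ℚ`, for a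
  free `ℤ/p^n`-module and a datum with THE canonical comparison maps whose primes lie in the
  `τ`-class: `H¹(ℚ_𝔮, T)/H¹_ur` is free of rank one too (through the admissible `φ^{fs}_𝔮`, file 10).
  These are the "local freeness" binders of the rescaling route (n1011-p13 `KolyvaginRescaling.lean`,
  "Rubin Ex. 1.9.7 — a hypothesis of the typed theorem"), now theorems.

References: B. Mazur, K. Rubin, Mem. AMS 799 (2004), Lemma 1.2.1 (i), Lemma 1.2.3 (pp. 10–11);
K. Rubin, PCMI 18 (2011), Prop. 1.4.13 (1), Ex. 1.9.7; R. Sakamoto, JTNB 36 (2024) §4 p. 925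
("`H¹_ur(K_𝔮, T) ≅ T/(Fr_𝔮 − 1)T ≅ R`").
-/

noncomputable section

open scoped Classical NumberField ContRepresentation
open Field NumberField IsDedekindDomain
open Literature.NumberTheory.GaloisRepresentations Literature.NumberTheory.GaloisRepresentations.DiscreteGaloisModule
  Literature.NumberTheory.GaloisCohomology

namespace Summit.BirchSwinnertonDyer.Rank1Residual.GaloisImage.FSComp

/-! ### §1 Local: `H¹_ur(F, M) ≃ M/(φ − 1)M` by evaluation at a Frobenius -/

section Local

universe u

variable {F : Type u} [Field F] [ValuativeRel F] [TopologicalSpace F] [IsNonarchimedeanLocalField F]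
variable {M : Type u} [AddCommGroup M] [TopologicalSpace M] [DiscreteTopology M] [Finite M]
variable (ρ : DiscreteGaloisModule F M)

/-- **`H¹_ur(F, M) ≅ M/(φ − 1)M` (Rubin PCMI Prop. 1.4.13 (1); [MR04] Lemma 1.2.1 (i): "induced by
evaluating cocycle classes on Frobenius")** for a finite unramified module and an arithmetic
Frobenius `φ`, as an additive isomorphism.
[cite: Rubin2011, Prop. 1.4.13 (1) (p. 9)] [cite: MazurRubin2004, Lemma 1.2.1 (i) (p. 10)] -/
theorem nonempty_unramifiedSubgroup_addEquiv_cokerSubOne (hI : ∀ τ ∈ absInertia F, ρ τ = 1)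
    {φ : absoluteGaloisGroup F} (hφ : IsAbsArithFrob φ) :
    Nonempty (unramifiedSubgroup ρ 1 ≃+ cokerSubOne ρ φ) := by
  classical
  have hI' : ∀ τ ∈ absInertia F, ∀ w : M, ρ τ w = w := fun τ hτ w => by
    rw [hI τ hτ, Module.End.one_apply]
  set R := ((ρ φ : M →ₗ[ℤ] M).toAddMonoidHom - AddMonoidHom.id M).range with hR
  -- evaluation at `φ`, descended to `H¹`
  let f : contOneCocycles ρ.toTopRep →+ M ⧸ R :=
    { toFun := fun z => QuotientAddGroup.mk (z.1 φ)
      map_zero' := by simp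
      map_add' := fun z w => by rw [Submodule.coe_add, ContinuousMap.add_apply, QuotientAddGroup.mk_add] }
  have hf : ∀ z, f z = QuotientAddGroup.mk (z.1 φ) := fun _ => rfl
  obtain ⟨ev, hev⟩ := exists_lift_of_oneCocycles ρ f (fun z hz => by
    obtain ⟨v, hv⟩ := (oneCocycleClass_eq_zero_iff _ z).mp hz
    rw [hf, QuotientAddGroup.eq_zero_iff, hv φ]
    exact ⟨v, rfl⟩)
  -- restricted to `H¹_ur`
  let e : unramifiedSubgroup ρ 1 → cokerSubOne ρ φ := fun x => ev x.1
  have he_add : ∀ x y, e (x + y) = e x + e y := fun x y => by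
    change ev ((x + y : unramifiedSubgroup ρ 1) : galoisCohomology ρ 1) = ev x.1 + ev y.1
    rw [AddSubgroup.coe_add, map_add]
  -- injective (file 3)
  have hinj : Function.Injective e := by
    intro x y hxy
    have hsub : ev ((x - y : unramifiedSubgroup ρ 1) : galoisCohomology ρ 1) = 0 := by
      rw [AddSubgroup.coe_sub, map_sub, sub_eq_zero]; exact hxy
    obtain ⟨z, hz⟩ := oneCocycleClass_surjective ρ.toTopRep (x - y).1
    have hzur : oneCocycleClass ρ.toTopRep z ∈ unramifiedSubgroup ρ 1 := by rw [hz]; exact (x - y).2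
    have hz0 : ∀ τ ∈ absInertia F, z.1 τ = 0 :=
      (X11b.LocBridge.mem_unramifiedSubgroup_one_iff_forall_eq_zero ρ hI' z).mp hzur
    rw [← hz, hev, hf, QuotientAddGroup.eq_zero_iff] at hsub
    obtain ⟨m, hm⟩ := hsub
    have hm' : z.1 φ = ρ φ m - m := by
      rw [← hm, AddMonoidHom.sub_apply, LinearMap.toAddMonoidHom_coe, AddMonoidHom.id_apply]
    have hcl := oneCocycleClass_eq_zero_of_apply_frob_eq ρ hI hφ z hz0 hm'
    rw [hz] at hcl
    exact sub_eq_zero.mp (Subtype.ext hcl)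
  -- counting: `#H¹_ur = #M^{Γ} = #ker (φ − id) = #M/(φ − 1)M`
  have hcard : Nat.card (unramifiedSubgroup ρ 1) = Nat.card (cokerSubOne ρ φ) := by
    rw [natCard_unramifiedSubgroup_eq_natCard_invariants ρ hI',
      ← natCard_ker_eq_natCard_quotient_range]
    refine Nat.card_congr (Equiv.subtypeEquivRight fun m => ?_)
    change (∀ g : absoluteGaloisGroup F, ρ g m = m) ↔
      m ∈ ((ρ φ : M →ₗ[ℤ] M).toAddMonoidHom - AddMonoidHom.id M).ker
    rw [AddMonoidHom.mem_ker, AddMonoidHom.sub_apply, LinearMap.toAddMonoidHom_coe,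
      AddMonoidHom.id_apply, sub_eq_zero]
    exact ⟨fun h => h φ, fun h g => forall_apply_eq_of_frob_apply_eq ρ hI hφ h g⟩
  haveI : Finite (cokerSubOne ρ φ) := inferInstance
  have hbij : Function.Bijective e := (Nat.bijective_iff_injective_and_card e).mpr ⟨hinj, hcard⟩
  exact ⟨AddEquiv.ofBijective (AddMonoidHom.mk' e he_add) hbij⟩

end Local

/-! ### §2 At Sakamoto's primes: `H¹_ur(K_𝔮, T)` is free of rank one over `ℤ/N` -/

section TauClass

universe u

variable {K : Type u} [Field K] [NumberField K] {M : Type u} [AddCommGroup M] [TopologicalSpace M]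
  [DiscreteTopology M] [Finite M] (ρ : DiscreteGaloisModule K M)

/-- **`H¹_ur(K_𝔮, T) ≅ ℤ/N` at a prime of Sakamoto's `τ`-class** (any number field): a local
arithmetic Frobenius acts on `T` as a conjugate of `τ` (n1011-p04 `exists_toLocal_eq_conj`), so
`T/(Fr − 1)T ≅ T/(τ − 1)T ≅ ℤ/N` ((H.2)), and §1 gives `H¹_ur ≅ T/(Fr − 1)T`.  Sakamoto §4, p. 925:
"`H¹_ur(K_𝔮, T) ≅ T/(Fr_𝔮 − 1)T ≅ R`"; [MR04] Lemma 1.2.3: "`H¹_f(K, T)` … free of rank one over `R`".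
[cite: Sakamoto2024, §4 (p. 925)] [cite: MazurRubin2004, Lemma 1.2.3 (p. 10–11)] -/
theorem isFreeRankOneZMod_unramifiedSubgroup_of_mem_frobeniusClassPrimes {N : ℕ}
    {S : Set (HeightOneSpectrum (𝓞 K))} {τ : absoluteGaloisGroup K}
    (hτq : Nonempty (cokerSubOne ρ τ ≃+ ZMod N)) {q : HeightOneSpectrum (𝓞 K)}
    (hq : q ∈ frobeniusClassPrimes ρ S τ N) :
    KolyvaginSystem.IsFreeRankOneZMod (unramifiedSubgroup (GaloisRep.toLocal q ρ) 1) N := by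
  have hI : ∀ t ∈ absInertia (q.adicCompletion K), GaloisRep.toLocal q ρ t = 1 := fun t ht =>
    (GaloisRep.isUnramifiedAt_iff_toLocal_holds q ρ).1 hq.2.2.1 t ht
  obtain ⟨φ, hφ⟩ := exists_isAbsArithFrob_holds (F := q.adicCompletion K)
  obtain ⟨g, hg⟩ := exists_toLocal_eq_conj ρ N S τ hq hφ
  obtain ⟨e₁⟩ := nonempty_unramifiedSubgroup_addEquiv_cokerSubOne (GaloisRep.toLocal q ρ) hI hφ
  obtain ⟨e₂⟩ := nonempty_cokerSubOne_equiv_of_eq_conj ρ (GaloisRep.toLocal q ρ) hg hτq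
  exact ⟨e₁.trans e₂⟩

end TauClass

/-! ### §3 Over `ℚ` with the canonical comparison maps: the singular quotient is free of rank one too -/

section Singular

variable {M : Type} [AddCommGroup M] [TopologicalSpace M] [DiscreteTopology M]
variable (ρ : DiscreteGaloisModule ℚ M) (p n : ℕ) [Fact p.Prime] [NeZero n]
  [Module (ZMod (p ^ n)) M] [Module.Free (ZMod (p ^ n)) M] [Module.Finite (ZMod (p ^ n)) M]

/-- **`H¹(ℚ_𝔮, T)/H¹_ur ≅ ℤ/p^n` at the primes of a canonical datum inside the `τ`-class** ([MR04]
Lemma 1.2.3: "`H¹_s(K, T)` … free of rank one over `R`"): the admissible comparison map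
`φ^{fs}_𝔮 : H¹_ur ⥲ H¹/H¹_ur` (file 10, `isAdmissible_of_hasCanonicalComparison_of_subset_primePow`)
composed with §2. [cite: MazurRubin2004, Lemma 1.2.3 (p. 10–11)] [cite: Rubin2011, Exercise 1.9.7 (p. 15)] -/
theorem isFreeRankOneZMod_singularQuotient_of_hasCanonicalComparison_primePow
    (S : Set (HeightOneSpectrum (𝓞 ℚ))) {τ : absoluteGaloisGroup ℚ}
    (hτq : Nonempty (cokerSubOne ρ τ ≃+ ZMod (p ^ n))) (hτμ : τ ∈ rootsOfUnityFixer ℚ (p ^ n))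
    {D : KolyvaginDatum ρ} (hP : D.primes ⊆ frobeniusClassPrimes ρ S τ (p ^ n))
    {η : (q : HeightOneSpectrum (𝓞 ℚ)) → (ZMod (Ideal.absNorm q.asIdeal))ˣ}
    (hD : D.HasCanonicalComparison (p ^ n) η) {q : HeightOneSpectrum (𝓞 ℚ)} (hq : q ∈ D.primes) :
    KolyvaginSystem.IsFreeRankOneZMod (SingularQuotient (GaloisRep.toLocal q ρ)) (p ^ n) := by
  haveI : Finite M := Module.finite_of_finite (ZMod (p ^ n))
  have hadm := isAdmissible_of_hasCanonicalComparison_of_subset_primePow ρ p n S hτq hτμ hP hD q hq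
  obtain ⟨e₁⟩ := isFreeRankOneZMod_unramifiedSubgroup_of_mem_frobeniusClassPrimes ρ hτq (hP hq)
  -- the admissible comparison map `H¹_ur ⥲ H¹/H¹_ur`, bundled
  let fsr : unramifiedSubgroup (GaloisRep.toLocal q ρ) 1 →+ SingularQuotient (GaloisRep.toLocal q ρ) :=
    AddMonoidHom.mk' (fun x => D.fs q (x : galoisCohomology (GaloisRep.toLocal q ρ) 1))
      fun x y => by rw [AddSubgroup.coe_add, map_add]
  have hfsr : Function.Bijective fsr := hadm
  exact ⟨(AddEquiv.ofBijective fsr hfsr).symm.trans e₁⟩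

end Singular

end Summit.BirchSwinnertonDyer.Rank1Residual.GaloisImage.FSComp

end
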